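import Mathlib
import Summits.CriticalPhenomena.Ising3DConformalLimit.Theses.PrecisionLaplacian

/-!
# Stub `stub_dirichletPrinciple` of line `diffusive-branch-is-nonsaturation` (crux
# `PrecisionLaplacian.DirectCorrelationStableTail`, stmt-CriticalPhenomena-4799): the finite-volume
# DIRICHLET PRINCIPLE for nonnegative test functions

**Statement** (registered text, = `stub_dirichletPrinciple` of the lead's skeleton).  Let `G` be a
translation-invariant kernel on `ℤ³` all of whose finite kernel matrices
`G_A = (G(q − p))_{p,q ∈ A}` are symmetric potentials (positive definite, inverse a Z-matrix with
nonnegative row sums) and whose inverse diagonal entries `(G_A)⁻¹(0,0)` are uniformly bounded by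
some `C` (finite energy).  With the precision row `m(y) = inf_{A ∋ 0,y} −(G_A)⁻¹(0,y)`, for every
finite `S ⊂ ℤ³`, every `f` and every `h ≥ 0`:
`2 Σ_{x∈S} f(x)h(x) ≤ Σ_{x,y∈S} f(x)f(y)G(y−x) + Σ_{x,y∈S} h(x)h(y)(−m(y−x))`.

**Proof** (pure linear algebra, Ising-free).
* Block positivity (`dirichletPrinciple_two_dotProduct_le`): for `M = G_S` positive definite and
  vectors `F, H`, `0 ≤ (F − M⁻¹H)ᵀ M (F − M⁻¹H) = FᵀMF − 2FᵀH + HᵀM⁻¹H`.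
* Entrywise domination (`dirichletPrinciple_inv_apply_le`): `(G_S)⁻¹(x,y) = (G_{S−x})⁻¹(0,y−x)`
  (reindex along the translation `S − x ≃ S`, `Matrix.inv_submatrix_equiv`), and
  `−(G_{S−x})⁻¹(0,y−x) ≥ inf_A −(G_A)⁻¹(0,y−x)` by `ciInf_le`; the family is bounded below by `0`
  off the diagonal (Z-signs) and by `−C` on it.
* `h ≥ 0` lets the domination pass through the quadratic form in `h`.

Pure theorem file, no definitions, no `sorry`.  References: C. Dellacherie, S. Martínez,
J. San Martín, *Inverse M-matrices and ultrametric matrices*, LNM 2118 (2014), ch. 2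
[DellacherieMartinezSanmartin2014]; folklore (Dirichlet principle).
-/

noncomputable section

namespace Summit.CriticalPhenomena.Ising3DConformalLimit.Cruxes.DirectCorrelationStableTail.DiffusiveBranchIsNonsaturation

open scoped BigOperators Matrix
open Literature.Probability.LatticeModels

/-! ### Block positivity -/

/-- Block positivity of `[[M, 1], [1, M⁻¹]]` for a real positive definite `M`:
`2 FᵀH ≤ FᵀMF + HᵀM⁻¹H` (expand `0 ≤ (F − M⁻¹H)ᵀ M (F − M⁻¹H)`). [folklore] -/
theorem dirichletPrinciple_two_dotProduct_le {ι : Type*} [Fintype ι] [DecidableEq ι]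
    {M : Matrix ι ι ℝ} (hM : M.PosDef) (F H : ι → ℝ) :
    2 * (F ⬝ᵥ H) ≤ F ⬝ᵥ (M *ᵥ F) + H ⬝ᵥ (M⁻¹ *ᵥ H) := by
  have hdet : IsUnit M.det := (Matrix.isUnit_iff_isUnit_det _).mp hM.isUnit
  have hMT : Mᵀ = M := by
    have h := hM.isHermitian
    rw [Matrix.IsHermitian, Matrix.conjTranspose_eq_transpose_of_trivial] at h
    exact h
  have h0 := hM.posSemidef.dotProduct_mulVec_nonneg (F - M⁻¹ *ᵥ H)
  simp only [star_trivial] at h0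
  have h1 : M *ᵥ (F - M⁻¹ *ᵥ H) = M *ᵥ F - H := by
    rw [Matrix.mulVec_sub, Matrix.mulVec_mulVec, Matrix.mul_nonsing_inv _ hdet, Matrix.one_mulVec]
  have h2 : (M⁻¹ *ᵥ H) ⬝ᵥ (M *ᵥ F) = H ⬝ᵥ F := by
    rw [Matrix.dotProduct_mulVec, ← Matrix.mulVec_transpose, hMT, Matrix.mulVec_mulVec,
      Matrix.mul_nonsing_inv _ hdet, Matrix.one_mulVec]
  rw [h1, sub_dotProduct, dotProduct_sub, dotProduct_sub, h2, dotProduct_comm (M⁻¹ *ᵥ H) H,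
    dotProduct_comm H F] at h0
  linarith

/-- The Dirichlet inequality in `Finset`-sum form, given ANY kernel `K` dominating the inverse
kernel matrix entrywise, `(G_S)⁻¹(x,y) ≤ K x y`, and a nonnegative test function `h`. [folklore] -/
theorem dirichletPrinciple_of_dom {α : Type*} [DecidableEq α] {S : Finset α} {g : α → α → ℝ}
    (K : α → α → ℝ) (hPD : (Matrix.of fun p q : ↥S => g p.1 q.1).PosDef)
    (hdom : ∀ p q : ↥S, (Matrix.of fun p q : ↥S => g p.1 q.1)⁻¹ p q ≤ K p.1 q.1)
    (f h : α → ℝ) (hh : ∀ x, 0 ≤ h x) :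
    2 * ∑ x ∈ S, f x * h x ≤
      (∑ x ∈ S, ∑ y ∈ S, f x * f y * g x y) + ∑ x ∈ S, ∑ y ∈ S, h x * h y * K x y := by
  set M : Matrix ↥S ↥S ℝ := Matrix.of fun p q : ↥S => g p.1 q.1 with hM
  have hblock := dirichletPrinciple_two_dotProduct_le hPD (fun p : ↥S => f p.1) (fun p : ↥S => h p.1)
  have e1 : ((fun p : ↥S => f p.1) ⬝ᵥ fun p : ↥S => h p.1) = ∑ x ∈ S, f x * h x :=
    Finset.sum_coe_sort S (fun x => f x * h x)
  have e2 : ((fun p : ↥S => f p.1) ⬝ᵥ (M *ᵥ fun p : ↥S => f p.1)) =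
      ∑ x ∈ S, ∑ y ∈ S, f x * f y * g x y := by
    rw [← Finset.sum_coe_sort S]
    refine Finset.sum_congr rfl fun p _ => ?_
    rw [← Finset.sum_coe_sort S]
    simp only [Matrix.mulVec, dotProduct, hM, Matrix.of_apply, Finset.mul_sum]
    exact Finset.sum_congr rfl fun q _ => by ring
  have e3 : ((fun p : ↥S => h p.1) ⬝ᵥ (M⁻¹ *ᵥ fun p : ↥S => h p.1)) =
      ∑ p : ↥S, ∑ q : ↥S, h p.1 * h q.1 * M⁻¹ p q := by
    simp only [Matrix.mulVec, dotProduct, Finset.mul_sum]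
    exact Finset.sum_congr rfl fun p _ => Finset.sum_congr rfl fun q _ => by ring
  have e4 : ∑ x ∈ S, ∑ y ∈ S, h x * h y * K x y = ∑ p : ↥S, ∑ q : ↥S, h p.1 * h q.1 * K p.1 q.1 := by
    rw [← Finset.sum_coe_sort S]
    exact Finset.sum_congr rfl fun p _ => (Finset.sum_coe_sort S _).symm
  rw [e1, e2, e3] at hblock
  rw [e4]
  refine hblock.trans (add_le_add le_rfl (Finset.sum_le_sum fun p _ =>
    Finset.sum_le_sum fun q _ => ?_))
  exact mul_le_mul_of_nonneg_left (hdom p q) (mul_nonneg (hh _) (hh _))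

/-! ### Translation of the kernel matrices -/

/-- Translating the index set does not change the inverse kernel matrix:
`(G_S)⁻¹(x,y) = (G_{S−x})⁻¹(0,y−x)` (reindexing along `S − x ≃ S`). [folklore] -/
theorem dirichletPrinciple_inv_apply_translate {α : Type*} [AddCommGroup α] [DecidableEq α]
    (G : α → ℝ) (S : Finset α) (p q : ↥S) :
    ∃ (h0 : (0 : α) ∈ S.image (· - p.1)) (hy : q.1 - p.1 ∈ S.image (· - p.1)),
      (Matrix.of fun a b : ↥(S.image (· - p.1)) => G (b.1 - a.1))⁻¹ ⟨0, h0⟩ ⟨q.1 - p.1, hy⟩ =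
        (Matrix.of fun a b : ↥S => G (b.1 - a.1))⁻¹ p q := by
  set T : Finset α := S.image (· - p.1) with hT
  have hmem : ∀ a : α, a ∈ T ↔ a + p.1 ∈ S := by
    intro a
    simp only [hT, Finset.mem_image]
    constructor
    · rintro ⟨z, hz, rfl⟩
      simpa using hz
    · intro ha
      exact ⟨a + p.1, ha, by simp⟩
  have h0 : (0 : α) ∈ T := (hmem 0).2 (by simp)
  have hy : q.1 - p.1 ∈ T := (hmem _).2 (by simp)
  refine ⟨h0, hy, ?_⟩
  set e : ↥T ≃ ↥S := (Equiv.addRight p.1).subtypeEquiv fun a => hmem a with he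
  have hsub : (Matrix.of fun a b : ↥T => G (b.1 - a.1)) =
      (Matrix.of fun a b : ↥S => G (b.1 - a.1)).submatrix e e := by
    ext a b
    simp only [Matrix.submatrix_apply, Matrix.of_apply, he, Equiv.subtypeEquiv_apply,
      Equiv.coe_addRight, add_sub_add_right_eq_sub]
  have hp : e ⟨0, h0⟩ = p := Subtype.ext (by simp [he])
  have hq : e ⟨q.1 - p.1, hy⟩ = q := Subtype.ext (by simp [he])
  rw [hsub, Matrix.inv_submatrix_equiv, Matrix.submatrix_apply, hp, hq]

/-! ### Entrywise domination by the precision row -/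

/-- Entrywise domination of the inverse kernel matrix by (minus) the precision row:
`(G_S)⁻¹(x,y) ≤ −inf_{A ∋ 0, y−x} (−(G_A)⁻¹(0,y−x))`, the infimum being attained-or-beaten at
`A = S − x` and the family being bounded below (Z-signs off the diagonal, finite energy on it).
[DellacherieMartinezSanmartin2014 ch. 2] -/
theorem dirichletPrinciple_inv_apply_le {α : Type*} [AddCommGroup α] [DecidableEq α]
    (G : α → ℝ)
    (HP : ∀ A : Finset α, (Matrix.of fun (p q : ↥A) => G (q.1 - p.1)).PosDef ∧
      ∀ u v : ↥A, (u ≠ v → (Matrix.of fun (p q : ↥A) => G (q.1 - p.1))⁻¹ u v ≤ 0) ∧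
        0 ≤ ∑ w, (Matrix.of fun (p q : ↥A) => G (q.1 - p.1))⁻¹ u w)
    {C : ℝ} (hC : ∀ (A : Finset α) (h0 : (0 : α) ∈ A),
      (Matrix.of fun (p q : ↥A) => G (q.1 - p.1))⁻¹ ⟨0, h0⟩ ⟨0, h0⟩ ≤ C)
    (S : Finset α) (p q : ↥S) :
    (Matrix.of fun a b : ↥S => G (b.1 - a.1))⁻¹ p q ≤
      -(⨅ A : {A : Finset α // (0 : α) ∈ A ∧ q.1 - p.1 ∈ A},
        -((Matrix.of fun (a b : ↥A.1) => G (b.1 - a.1))⁻¹ ⟨0, A.2.1⟩ ⟨q.1 - p.1, A.2.2⟩)) := by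
  obtain ⟨h0, hy, hT⟩ := dirichletPrinciple_inv_apply_translate G S p q
  rw [le_neg, ← hT]
  refine ciInf_le ?_ (⟨S.image (· - p.1), h0, hy⟩ : {A : Finset α // (0 : α) ∈ A ∧ q.1 - p.1 ∈ A})
  refine ⟨-(max C 0), ?_⟩
  rintro _ ⟨A, rfl⟩
  dsimp only
  rw [neg_le_neg_iff]
  by_cases hpq : q.1 - p.1 = 0
  · have hidx : (⟨q.1 - p.1, A.2.2⟩ : ↥A.1) = ⟨0, A.2.1⟩ := Subtype.ext hpq
    rw [hidx]
    exact (hC A.1 A.2.1).trans (le_max_left _ _)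
  · have hne : (⟨0, A.2.1⟩ : ↥A.1) ≠ ⟨q.1 - p.1, A.2.2⟩ :=
      fun e => hpq (congrArg Subtype.val e).symm
    exact (((HP A.1).2 ⟨0, A.2.1⟩ ⟨q.1 - p.1, A.2.2⟩).1 hne).trans (le_max_right _ _)

/-! ### The registered stub -/

/-- **Stub `stub_dirichletPrinciple` (finite-volume Dirichlet principle for nonnegative test
functions; `H` only).**  For a translation-invariant kernel `G` on `ℤ³` all of whose finite kernel
matrices are symmetric potentials, and whose inverse diagonal entries `(G_A)⁻¹(0,0)` are uniformly
bounded (finite energy), the precision row `m(y) = inf_{A ∋ 0,y} −(G_A)⁻¹(0,y)` satisfies, for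
every finite `S`, every `f` and every `h ≥ 0`:
`2 Σ_{x∈S} f(x)h(x) ≤ Σ_{x,y∈S} f(x)f(y)G(y−x) + Σ_{x,y∈S} h(x)h(y)(−m(y−x))`.
[DellacherieMartinezSanmartin2014 ch. 2; folklore (Dirichlet principle)] -/
theorem stub_dirichletPrinciple :
    ∀ (G : Site 3 → ℝ), (∀ A : Finset (Site 3), (Matrix.of fun (p q : ↥A) => G (q.1 - p.1)).PosDef ∧
      ∀ u v : ↥A, (u ≠ v → (Matrix.of fun (p q : ↥A) => G (q.1 - p.1))⁻¹ u v ≤ 0) ∧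
        0 ≤ ∑ w, (Matrix.of fun (p q : ↥A) => G (q.1 - p.1))⁻¹ u w) →
    (∃ C : ℝ, ∀ (A : Finset (Site 3)) (h0 : (0 : Site 3) ∈ A),
      (Matrix.of fun (p q : ↥A) => G (q.1 - p.1))⁻¹ ⟨0, h0⟩ ⟨0, h0⟩ ≤ C) →
    ∀ (S : Finset (Site 3)) (f h : Site 3 → ℝ), (∀ x, 0 ≤ h x) →
      2 * ∑ x ∈ S, f x * h x ≤ (∑ x ∈ S, ∑ y ∈ S, f x * f y * G (y - x)) +
        ∑ x ∈ S, ∑ y ∈ S, h x * h y * -(⨅ A : {A : Finset (Site 3) // (0 : Site 3) ∈ A ∧ y - x ∈ A},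
          -((Matrix.of fun (p q : ↥A.1) => G (q.1 - p.1))⁻¹ ⟨0, A.2.1⟩ ⟨y - x, A.2.2⟩)) := by
  intro G HP hC S f h hh
  obtain ⟨C, hC⟩ := hC
  exact dirichletPrinciple_of_dom (g := fun x y => G (y - x))
    (fun x y => -(⨅ A : {A : Finset (Site 3) // (0 : Site 3) ∈ A ∧ y - x ∈ A},
      -((Matrix.of fun (p q : ↥A.1) => G (q.1 - p.1))⁻¹ ⟨0, A.2.1⟩ ⟨y - x, A.2.2⟩)))
    (HP S).1 (fun p q => dirichletPrinciple_inv_apply_le G HP hC S p q) f h hh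

end Summit.CriticalPhenomena.Ising3DConformalLimit.Cruxes.DirectCorrelationStableTail.DiffusiveBranchIsNonsaturation
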